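import Mathlib.Probability.Distributions.Gaussian.Multivariate
import Mathlib.Analysis.InnerProductSpace.Projection.FiniteDimensional
import Mathlib.Analysis.Normed.Lp.MeasurableSpace
import HarnessLib

/-!
# Mean / fluctuation decomposition of i.i.d. Gaussian vectors (Helmert)

`Literature/Probability/Distributions/`. For `n = N + 1 ≥ 2` independent standard Gaussian vectors
`w₀, …, w_N` of a finite-dimensional real inner product space `V` (`k = dim V`), the rescaled
empirical mean `c = n^{-1/2} ∑ wᵢ`, the rescaled fluctuation of the first vector
`x = (w₀ − w̄)/√(1 − 1/n)` and (suitable orthonormal coordinates `z ∈ ℝ^{(n−2)k}` of) the remaining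
fluctuations are independent standard Gaussians, with `∑ ‖wᵢ‖² = ‖c‖² + ‖x‖² + ‖z‖²`
(`exists_gaussian_helmert`). This is the Gaussian content of the Helmert transformation
(orthogonal invariance of `⊗ⁿ γ_V`), phrased without matrices:

* `stdGaussian_map_eq_of_inner_eq` — a measurable map `L` between inner product spaces admitting
  an isometric "adjoint" `M` (`⟪L w, t⟫ = ⟪w, M t⟫`, `‖M t‖ = ‖t‖`) pushes `γ` to `γ`
  (characteristic functions, `charFun_stdGaussian`);
* `stdGaussian_prod_map_ofLp`, `stdGaussian_piLp_map_ofLp` — `γ` of an `L²`-product / `L²`-power is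
  the product measure (`charFun_eq_prod_iff`, `charFun_eq_pi_iff`);
* `stdGaussian_map_adjoint_prod_eq` — for an isometric embedding `J : G → 𝔼` with adjoint `J'`,
  `w ↦ (J' w, P_{(JG)ᗮ} w)` pushes `γ_𝔼` to `γ_G ⊗ γ_{(JG)ᗮ}`, and `‖w‖² = ‖J'w‖² + ‖P w‖²`;
* `exists_gaussian_helmert` — the Helmert instance `G = V ⊕ V`, `J(u, v)ᵢ = n^{-1/2} u + rᵢ v` with
  the contrast `r = (√N, −1/√N, …, −1/√N)/√n`.

All [folklore] (F. R. Helmert, Z. Math. Phys. 21 (1876) 192–218; e.g. C. R. Rao, *Linear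
statistical inference*, §3b.3).
-/

noncomputable section

open MeasureTheory ProbabilityTheory Module WithLp Complex
open scoped ENNReal RealInnerProductSpace

namespace Literature.Probability.Distributions

/-! ### Gaussian invariance under co-isometries; `L²`-products -/

section General

variable {𝔼 : Type*} [NormedAddCommGroup 𝔼] [InnerProductSpace ℝ 𝔼] [FiniteDimensional ℝ 𝔼]
  [MeasurableSpace 𝔼] [BorelSpace 𝔼]
variable {𝔽 : Type*} [NormedAddCommGroup 𝔽] [InnerProductSpace ℝ 𝔽] [FiniteDimensional ℝ 𝔽]
  [MeasurableSpace 𝔽] [BorelSpace 𝔽]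

/-- **Co-isometries preserve the standard Gaussian.** If a measurable `L : 𝔼 → 𝔽` admits
`M : 𝔽 → 𝔼` with `⟪L w, t⟫ = ⟪w, M t⟫` and `‖M t‖ = ‖t‖` (a linear map with isometric adjoint,
`L L* = 1`), then `L_* γ_𝔼 = γ_𝔽`: `(L_*γ)^(t) = γ̂(M t) = e^{-‖M t‖²/2} = e^{-‖t‖²/2}`. [folklore] -/
theorem stdGaussian_map_eq_of_inner_eq {L : 𝔼 → 𝔽} (hL : Measurable L) (M : 𝔽 → 𝔼)
    (hadj : ∀ w t, ⟪L w, t⟫ = ⟪w, M t⟫) (hM : ∀ t, ‖M t‖ = ‖t‖) :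
    (stdGaussian 𝔼).map L = stdGaussian 𝔽 := by
  haveI : IsProbabilityMeasure ((stdGaussian 𝔼).map L) :=
    Measure.isProbabilityMeasure_map hL.aemeasurable
  refine Measure.ext_of_charFun (funext fun t => ?_)
  have hmeas : Measurable fun x : 𝔽 => cexp ((⟪x, t⟫ : ℂ) * I) := by fun_prop
  rw [charFun_apply, integral_map hL.aemeasurable hmeas.aestronglyMeasurable, charFun_stdGaussian]
  simp_rw [hadj]
  rw [← charFun_apply, charFun_stdGaussian, hM]

variable {A : Type*} [NormedAddCommGroup A] [InnerProductSpace ℝ A] [FiniteDimensional ℝ A]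
  [MeasurableSpace A] [BorelSpace A]
variable {B : Type*} [NormedAddCommGroup B] [InnerProductSpace ℝ B] [FiniteDimensional ℝ B]
  [MeasurableSpace B] [BorelSpace B]

/-- The standard Gaussian of the `L²`-product `A ⊕ B` is `γ_A ⊗ γ_B` (on the plain product type).
[folklore] -/
theorem stdGaussian_prod_map_ofLp :
    (stdGaussian (WithLp 2 (A × B))).map ofLp = (stdGaussian A).prod (stdGaussian B) := by
  haveI : IsProbabilityMeasure ((stdGaussian (WithLp 2 (A × B))).map ofLp) :=
    Measure.isProbabilityMeasure_map (WithLp.measurable_ofLp 2 _).aemeasurable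
  refine (charFun_eq_prod_iff (ξ := (stdGaussian (WithLp 2 (A × B))).map ofLp)
    (μ := stdGaussian A) (ν := stdGaussian B)).1 fun t => ?_
  rw [Measure.map_map (WithLp.measurable_toLp 2 _) (WithLp.measurable_ofLp 2 _),
    show (toLp 2 ∘ ofLp : WithLp 2 (A × B) → WithLp 2 (A × B)) = id from funext fun x => rfl,
    Measure.map_id, charFun_stdGaussian, charFun_stdGaussian, charFun_stdGaussian, ← Complex.exp_add]
  congr 1
  have h := WithLp.prod_norm_sq_eq_of_L2 t
  have hc : ((‖t‖ : ℂ)) ^ 2 = (‖(ofLp t).1‖ : ℂ) ^ 2 + (‖(ofLp t).2‖ : ℂ) ^ 2 := by exact_mod_cast h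
  rw [hc]
  ring

variable {ι : Type*} [Fintype ι]

/-- The standard Gaussian of the `L²`-power `⊕_ι A` is the product measure `⊗_ι γ_A` (on the plain
function type). [folklore] -/
theorem stdGaussian_piLp_map_ofLp :
    (stdGaussian (PiLp 2 fun _ : ι => A)).map ofLp = Measure.pi fun _ : ι => stdGaussian A := by
  haveI : IsProbabilityMeasure ((stdGaussian (PiLp 2 fun _ : ι => A)).map ofLp) :=
    Measure.isProbabilityMeasure_map (WithLp.measurable_ofLp 2 _).aemeasurable
  refine (charFun_eq_pi_iff (ν := (stdGaussian (PiLp 2 fun _ : ι => A)).map ofLp)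
    (μ := fun _ : ι => stdGaussian A)).1 fun t => ?_
  rw [Measure.map_map (WithLp.measurable_toLp 2 _) (WithLp.measurable_ofLp 2 _),
    show (toLp 2 ∘ ofLp : (PiLp 2 fun _ : ι => A) → PiLp 2 fun _ : ι => A) = id from
      funext fun x => rfl, Measure.map_id, charFun_stdGaussian]
  simp_rw [charFun_stdGaussian]
  rw [← Complex.exp_sum]
  congr 1
  have h := PiLp.norm_sq_eq_of_L2 _ t
  have hc : ((‖t‖ : ℂ)) ^ 2 = ∑ i, (‖t i‖ : ℂ) ^ 2 := by exact_mod_cast h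
  rw [hc]
  simp only [neg_div, Finset.sum_div, Finset.sum_neg_distrib]

/-! ### Orthogonal decomposition along an isometric embedding -/

variable {G : Type*} [NormedAddCommGroup G] [InnerProductSpace ℝ G] [FiniteDimensional ℝ G]
  [MeasurableSpace G] [BorelSpace G]

omit [FiniteDimensional ℝ 𝔼] [MeasurableSpace 𝔼] [BorelSpace 𝔼] [MeasurableSpace G] [BorelSpace G] in
/-- For an isometric linear embedding `J : G → 𝔼` with adjoint `J'` (`⟪J' w, t⟫ = ⟪w, J t⟫`) and
`P` the orthogonal projection onto `(JG)ᗮ`: `w = J(J'w) + Pw` and `‖w‖² = ‖J'w‖² + ‖Pw‖²`.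
[folklore] -/
theorem norm_sq_eq_of_isometry_adjoint (J : G →ₗ[ℝ] 𝔼) (hJ : ∀ t, ‖J t‖ = ‖t‖) (J' : 𝔼 →ₗ[ℝ] G)
    (hJ' : ∀ w t, ⟪J' w, t⟫ = ⟪w, J t⟫) (w : 𝔼) :
    J (J' w) + ((LinearMap.range J)ᗮ.orthogonalProjectionOnto w : 𝔼) = w ∧
      ‖w‖ ^ 2 = ‖J' w‖ ^ 2 + ‖(LinearMap.range J)ᗮ.orthogonalProjectionOnto w‖ ^ 2 := by
  have hJip : ∀ s t, ⟪J s, J t⟫ = ⟪s, t⟫ := fun s t => by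
    rw [real_inner_eq_norm_add_mul_self_sub_norm_mul_self_sub_norm_mul_self_div_two, ← map_add,
      hJ, hJ, hJ, ← real_inner_eq_norm_add_mul_self_sub_norm_mul_self_sub_norm_mul_self_div_two]
  have hJ'J : ∀ t, J' (J t) = t := fun t => by
    refine ext_inner_right ℝ fun s => ?_
    rw [hJ', hJip]
  have hJ'orth : ∀ z ∈ (LinearMap.range J)ᗮ, J' z = 0 := fun z hz => by
    refine ext_inner_right ℝ fun s => ?_
    rw [hJ', inner_zero_left]
    exact Submodule.inner_left_of_mem_orthogonal (LinearMap.mem_range_self J s) hz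
  obtain ⟨y, hy, z, hz, hw⟩ := (LinearMap.range J).exists_add_mem_mem_orthogonal w
  obtain ⟨s, rfl⟩ := LinearMap.mem_range.1 hy
  have hP : ((LinearMap.range J)ᗮ.orthogonalProjectionOnto w : 𝔼) = z := by
    have h1 : (LinearMap.range J)ᗮ.orthogonalProjectionOnto (J s) = 0 :=
      Submodule.orthogonalProjectionOnto_apply_of_mem_orthogonal
        (Submodule.le_orthogonal_orthogonal _ (LinearMap.mem_range_self J s))
    have h2 : (LinearMap.range J)ᗮ.orthogonalProjectionOnto z = ⟨z, hz⟩ :=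
      Submodule.orthogonalProjectionOnto_mem_subspace_eq_self (⟨z, hz⟩ : (LinearMap.range J)ᗮ)
    rw [hw, map_add, h1, h2, zero_add]
  have hJ'w : J' w = s := by rw [hw, map_add, hJ'J, hJ'orth z hz, add_zero]
  have horth : ⟪J s, z⟫ = 0 :=
    Submodule.inner_right_of_mem_orthogonal (LinearMap.mem_range_self J s) hz
  refine ⟨by rw [hJ'w, hP]; exact hw.symm, ?_⟩
  rw [hJ'w, Submodule.coe_norm, hP, hw, norm_add_sq_real, horth, mul_zero, add_zero, hJ]

omit [MeasurableSpace 𝔼] [BorelSpace 𝔼] [FiniteDimensional ℝ G] [MeasurableSpace G] [BorelSpace G] in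
/-- The dimension count `dim (JG)ᗮ = dim 𝔼 − dim G` for an isometric embedding `J`. [folklore] -/
theorem finrank_orthogonal_range_of_isometry (J : G →ₗ[ℝ] 𝔼) (hJ : ∀ t, ‖J t‖ = ‖t‖) :
    finrank ℝ (LinearMap.range J)ᗮ = finrank ℝ 𝔼 - finrank ℝ G := by
  have hinj : Function.Injective J := by
    intro s t hst
    have h : ‖J (s - t)‖ = 0 := by rw [map_sub, hst, sub_self, norm_zero]
    rw [hJ, norm_eq_zero, sub_eq_zero] at h
    exact h
  have h1 := Submodule.finrank_add_finrank_orthogonal (LinearMap.range J)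
  rw [LinearMap.finrank_range_of_inj hinj] at h1
  omega

variable {F' : Type*} [NormedAddCommGroup F'] [InnerProductSpace ℝ F'] [FiniteDimensional ℝ F']
  [MeasurableSpace F'] [BorelSpace F']

/-- **Gaussian orthogonal decomposition.** For an isometric linear embedding `J : G → 𝔼` with
adjoint `J'`, and orthonormal coordinates `e` on `(JG)ᗮ`, the map `w ↦ (J' w, e(P_{(JG)ᗮ} w))` pushes
the standard Gaussian of `𝔼` to `γ_G ⊗ γ_{F'}` — the two blocks are independent standard
Gaussians (its adjoint `(t, z) ↦ J t + e⁻¹ z` is an isometry; `stdGaussian_map_eq_of_inner_eq`).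
[folklore] -/
theorem stdGaussian_map_adjoint_prod_eq (J : G →ₗ[ℝ] 𝔼) (hJ : ∀ t, ‖J t‖ = ‖t‖) (J' : 𝔼 →ₗ[ℝ] G)
    (hJ' : ∀ w t, ⟪J' w, t⟫ = ⟪w, J t⟫) (e : (LinearMap.range J)ᗮ ≃ₗᵢ[ℝ] F') :
    (stdGaussian 𝔼).map
        (fun w => (J' w, e ((LinearMap.range J)ᗮ.orthogonalProjectionOnto w))) =
      (stdGaussian G).prod (stdGaussian F') := by
  have hJ'c : Continuous J' := J'.continuous_of_finiteDimensional
  have hPc : Continuous fun w => e ((LinearMap.range J)ᗮ.orthogonalProjectionOnto w) :=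
    e.continuous.comp (LinearMap.range J)ᗮ.orthogonalProjectionOnto.continuous
  have hLm : Measurable fun w : 𝔼 =>
      toLp 2 (J' w, e ((LinearMap.range J)ᗮ.orthogonalProjectionOnto w)) :=
    (WithLp.measurable_toLp 2 _).comp (hJ'c.measurable.prodMk hPc.measurable)
  have hmap : (stdGaussian 𝔼).map
      (fun w : 𝔼 => toLp 2 (J' w, e ((LinearMap.range J)ᗮ.orthogonalProjectionOnto w))) =
        stdGaussian (WithLp 2 (G × F')) := by
    refine stdGaussian_map_eq_of_inner_eq hLm
      (fun t => J (ofLp t).1 + ((e.symm (ofLp t).2 : (LinearMap.range J)ᗮ) : 𝔼))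
      (fun w t => ?_) (fun t => ?_)
    · rw [WithLp.prod_inner_apply, hJ', LinearIsometryEquiv.inner_map_eq_flip,
        Submodule.inner_orthogonalProjectionOnto_eq_of_mem_right, inner_add_right]
    · have horth : ⟪J (ofLp t).1, ((e.symm (ofLp t).2 : (LinearMap.range J)ᗮ) : 𝔼)⟫ = 0 :=
        Submodule.inner_right_of_mem_orthogonal (LinearMap.mem_range_self J _) (Submodule.coe_mem _)
      have h2 : ‖J (ofLp t).1 + ((e.symm (ofLp t).2 : (LinearMap.range J)ᗮ) : 𝔼)‖ ^ 2 = ‖t‖ ^ 2 := by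
        rw [norm_add_sq_real, horth, mul_zero, add_zero, hJ, Submodule.norm_coe,
          LinearIsometryEquiv.norm_map, WithLp.prod_norm_sq_eq_of_L2]
        rfl
      exact (sq_eq_sq₀ (norm_nonneg _) (norm_nonneg _)).1 h2
  have hcomp : (fun w => (J' w, e ((LinearMap.range J)ᗮ.orthogonalProjectionOnto w))) =
      ofLp ∘ fun w : 𝔼 => toLp 2 (J' w, e ((LinearMap.range J)ᗮ.orthogonalProjectionOnto w)) :=
    funext fun w => rfl
  rw [hcomp, ← Measure.map_map (WithLp.measurable_ofLp 2 _) hLm, hmap, stdGaussian_prod_map_ofLp]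

end General

/-! ### The Helmert decomposition -/

section Helmert

variable {V : Type*} [NormedAddCommGroup V] [InnerProductSpace ℝ V] [FiniteDimensional ℝ V]
  [MeasurableSpace V] [BorelSpace V]

omit [FiniteDimensional ℝ V] [MeasurableSpace V] [BorelSpace V] in
/-- Adjointness of the diagonal maps `w ↦ ∑ rᵢ wᵢ` and `u ↦ (rᵢ u)ᵢ` between `V` and `⊕ⁿ V`.
[folklore] -/
theorem inner_sum_smul_eq_inner_toLp {n : ℕ} (r : Fin n → ℝ) (w : PiLp 2 fun _ : Fin n => V)
    (u : V) : ⟪∑ i, r i • w i, u⟫ = ⟪w, toLp 2 fun i => r i • u⟫ := by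
  rw [PiLp.inner_apply, sum_inner]
  refine Finset.sum_congr rfl fun i _ => ?_
  rw [real_inner_smul_left, WithLp.ofLp_toLp, real_inner_smul_right]

omit [FiniteDimensional ℝ V] [MeasurableSpace V] [BorelSpace V] in
/-- Gram matrix of the diagonal maps: `⟪(rᵢ u)ᵢ, (sᵢ v)ᵢ⟫ = (∑ rᵢ sᵢ) ⟪u, v⟫`. [folklore] -/
theorem inner_toLp_smul_toLp_smul {n : ℕ} (r s : Fin n → ℝ) (u v : V) :
    ⟪(toLp 2 fun i => r i • u : PiLp 2 fun _ : Fin n => V), toLp 2 fun i => s i • v⟫ =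
      (∑ i, r i * s i) * ⟪u, v⟫ := by
  rw [PiLp.inner_apply, Finset.sum_mul]
  refine Finset.sum_congr rfl fun i _ => ?_
  rw [WithLp.ofLp_toLp, WithLp.ofLp_toLp, real_inner_smul_left, real_inner_smul_right, mul_assoc]

/-- The Helmert coefficient identities: with `s = √(N+1)`, `t = √N` (`N ≥ 1`) and the contrast
`r = (t/s, −1/(ts), …, −1/(ts))`, the rows `(1/s, …, 1/s)` and `r` are orthonormal, and
`(1/s)·(1/s) + (t/s)·rᵢ = δ_{i0}`. [folklore] -/
theorem helmert_coeff_identities (N : ℕ) (hN : 1 ≤ N) :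
    (∑ _i : Fin (N + 1), (Real.sqrt ((N : ℝ) + 1))⁻¹ * (Real.sqrt ((N : ℝ) + 1))⁻¹ = 1) ∧
    (∑ i : Fin (N + 1),
        (Fin.cons (Real.sqrt N / Real.sqrt ((N : ℝ) + 1))
            (fun _ => -(Real.sqrt N * Real.sqrt ((N : ℝ) + 1))⁻¹) : Fin (N + 1) → ℝ) i *
          (Fin.cons (Real.sqrt N / Real.sqrt ((N : ℝ) + 1))
            (fun _ => -(Real.sqrt N * Real.sqrt ((N : ℝ) + 1))⁻¹) : Fin (N + 1) → ℝ) i = 1) ∧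
    (∑ i : Fin (N + 1), (Real.sqrt ((N : ℝ) + 1))⁻¹ *
        (Fin.cons (Real.sqrt N / Real.sqrt ((N : ℝ) + 1))
          (fun _ => -(Real.sqrt N * Real.sqrt ((N : ℝ) + 1))⁻¹) : Fin (N + 1) → ℝ) i = 0) ∧
    ((Real.sqrt ((N : ℝ) + 1))⁻¹ * (Real.sqrt ((N : ℝ) + 1))⁻¹ +
        Real.sqrt N / Real.sqrt ((N : ℝ) + 1) * (Real.sqrt N / Real.sqrt ((N : ℝ) + 1)) = 1) ∧
    ((Real.sqrt ((N : ℝ) + 1))⁻¹ * (Real.sqrt ((N : ℝ) + 1))⁻¹ +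
        Real.sqrt N / Real.sqrt ((N : ℝ) + 1) * -(Real.sqrt N * Real.sqrt ((N : ℝ) + 1))⁻¹ = 0) := by
  set s : ℝ := Real.sqrt ((N : ℝ) + 1) with hs
  set t : ℝ := Real.sqrt N with ht
  have hN0 : (0 : ℝ) < N := by exact_mod_cast hN
  have hs2 : s ^ 2 = N + 1 := by rw [hs]; exact Real.sq_sqrt (by positivity)
  have ht2 : t ^ 2 = N := by rw [ht]; exact Real.sq_sqrt hN0.le
  have hs0 : s ≠ 0 := by rw [hs]; exact (Real.sqrt_pos.2 (by positivity)).ne'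
  have ht0 : t ≠ 0 := by rw [ht]; exact (Real.sqrt_pos.2 hN0).ne'
  clear_value s t
  refine ⟨?_, ?_, ?_, ?_, ?_⟩
  · rw [Finset.sum_const, Finset.card_univ, Fintype.card_fin, nsmul_eq_mul]
    field_simp
    push_cast
    linarith [hs2]
  · rw [Fin.sum_univ_succ]
    simp only [Fin.cons_zero, Fin.cons_succ, Finset.sum_const, Finset.card_univ, Fintype.card_fin,
      nsmul_eq_mul]
    field_simp
    nlinarith [hs2, ht2]
  · rw [Fin.sum_univ_succ]
    simp only [Fin.cons_zero, Fin.cons_succ, Finset.sum_const, Finset.card_univ, Fintype.card_fin,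
      nsmul_eq_mul]
    field_simp
    nlinarith [hs2, ht2]
  · field_simp
    nlinarith [hs2, ht2]
  · field_simp
    ring

/-- **Helmert decomposition of i.i.d. Gaussian vectors.** For `N ≥ 1` there is a measurable map
`T = (c, x, z) : (Fin (N+1) → V) → V × V × ℝ^{(N−1) dim V}` with: under `⊗^{N+1} γ_V` the three
components are independent standard Gaussians; `c = (N+1)^{-1/2} ∑ wᵢ` is the rescaled empirical
mean; `w₀ = (N+1)^{-1/2} c + √(N/(N+1)) · x` (so `x` is the normalised fluctuation `w₀ − w̄`); and
`∑ ‖wᵢ‖² = ‖c‖² + ‖x‖² + ‖z‖²` (orthogonality). [folklore] -/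
theorem exists_gaussian_helmert (N : ℕ) (hN : 1 ≤ N) :
    ∃ T : (Fin (N + 1) → V) → V × V × EuclideanSpace ℝ (Fin ((N - 1) * finrank ℝ V)),
      Measurable T ∧
      (Measure.pi fun _ : Fin (N + 1) => stdGaussian V).map T =
        (stdGaussian V).prod ((stdGaussian V).prod
          (stdGaussian (EuclideanSpace ℝ (Fin ((N - 1) * finrank ℝ V))))) ∧
      ∀ w, (T w).1 = (Real.sqrt ((N : ℝ) + 1))⁻¹ • ∑ i, w i ∧
        w 0 = (Real.sqrt ((N : ℝ) + 1))⁻¹ • (T w).1 + (Real.sqrt N / Real.sqrt ((N : ℝ) + 1)) • (T w).2.1 ∧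
        ∑ i, ‖w i‖ ^ 2 = ‖(T w).1‖ ^ 2 + ‖(T w).2.1‖ ^ 2 + ‖(T w).2.2‖ ^ 2 := by
  obtain ⟨S1, S2, S3, S4, S5⟩ := helmert_coeff_identities N hN
  set s : ℝ := Real.sqrt ((N : ℝ) + 1) with hs
  set t : ℝ := Real.sqrt N with ht
  set r : Fin (N + 1) → ℝ := Fin.cons (t / s) (fun _ => -(t * s)⁻¹) with hr
  have hr0 : r 0 = t / s := by rw [hr]; exact Fin.cons_zero _ _
  have hrs : ∀ j : Fin N, r j.succ = -(t * s)⁻¹ := fun j => by rw [hr]; exact Fin.cons_succ _ _ _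
  -- the spaces and the maps
  let 𝔼 := PiLp 2 fun _ : Fin (N + 1) => V
  let G := WithLp 2 (V × V)
  let ι : (Fin (N + 1) → ℝ) → V →ₗ[ℝ] 𝔼 := fun ρ =>
    (WithLp.linearEquiv 2 ℝ (Fin (N + 1) → V)).symm.toLinearMap ∘ₗ
      LinearMap.pi fun i => ρ i • LinearMap.id
  have hι : ∀ ρ u, ι ρ u = toLp 2 fun i => ρ i • u := fun ρ u => rfl
  let Λ : (Fin (N + 1) → ℝ) → 𝔼 →ₗ[ℝ] V := fun ρ =>
    { toFun := fun w => ∑ i, ρ i • w i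
      map_add' := fun w w' => by
        rw [← Finset.sum_add_distrib]
        exact Finset.sum_congr rfl fun i _ => smul_add (ρ i) (w i) (w' i)
      map_smul' := fun c w => by
        rw [RingHom.id_apply, Finset.smul_sum]
        exact Finset.sum_congr rfl fun i _ => smul_comm (ρ i) c (w i) }
  have hΛ : ∀ ρ (w : 𝔼), Λ ρ w = ∑ i, ρ i • w i := fun ρ w => rfl
  let J : G →ₗ[ℝ] 𝔼 := ι (fun _ => s⁻¹) ∘ₗ (LinearMap.fst ℝ V V ∘ₗ (WithLp.linearEquiv 2 ℝ (V × V)).toLinearMap) +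
    ι r ∘ₗ (LinearMap.snd ℝ V V ∘ₗ (WithLp.linearEquiv 2 ℝ (V × V)).toLinearMap)
  have hJ : ∀ g : G, J g = ι (fun _ => s⁻¹) (ofLp g).1 + ι r (ofLp g).2 := fun g => rfl
  let J' : 𝔼 →ₗ[ℝ] G := (WithLp.linearEquiv 2 ℝ (V × V)).symm.toLinearMap ∘ₗ
    LinearMap.prod (Λ fun _ => s⁻¹) (Λ r)
  have hJ' : ∀ w : 𝔼, J' w = toLp 2 (Λ (fun _ => s⁻¹) w, Λ r w) := fun w => rfl
  -- isometry and adjointness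
  have hJiso : ∀ g : G, ‖J g‖ = ‖g‖ := fun g => by
    have h2 : ‖J g‖ ^ 2 = ‖g‖ ^ 2 := by
      rw [hJ, hι, hι, norm_add_sq_real, ← real_inner_self_eq_norm_sq,
        ← real_inner_self_eq_norm_sq (toLp 2 fun i => r i • (ofLp g).2 : 𝔼),
        inner_toLp_smul_toLp_smul, inner_toLp_smul_toLp_smul, inner_toLp_smul_toLp_smul, S1, S2, S3,
        ← real_inner_self_eq_norm_sq g, WithLp.prod_inner_apply]
      ring
    exact (sq_eq_sq₀ (norm_nonneg _) (norm_nonneg _)).1 h2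
  have hJadj : ∀ (w : 𝔼) (g : G), ⟪J' w, g⟫ = ⟪w, J g⟫ := fun w g => by
    rw [hJ', hJ, WithLp.prod_inner_apply, inner_add_right, hΛ, hΛ, hι, hι,
      inner_sum_smul_eq_inner_toLp, inner_sum_smul_eq_inner_toLp]
  -- the coordinates on the orthogonal complement
  have hdim : finrank ℝ (LinearMap.range J)ᗮ = (N - 1) * finrank ℝ V := by
    rw [finrank_orthogonal_range_of_isometry J hJiso,
      (WithLp.linearEquiv 2 ℝ (Fin (N + 1) → V)).finrank_eq,
      (WithLp.linearEquiv 2 ℝ (V × V)).finrank_eq, Module.finrank_pi_fintype, Module.finrank_prod,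
      Finset.sum_const, Finset.card_univ, Fintype.card_fin, smul_eq_mul]
    obtain ⟨M, rfl⟩ : ∃ M, N = M + 1 := ⟨N - 1, by omega⟩
    rw [show (M + 1 + 1) * finrank ℝ V = M * finrank ℝ V + (finrank ℝ V + finrank ℝ V) by ring,
      Nat.add_sub_cancel, Nat.add_sub_cancel]
  let e : (LinearMap.range J)ᗮ ≃ₗᵢ[ℝ] EuclideanSpace ℝ (Fin ((N - 1) * finrank ℝ V)) :=
    ((stdOrthonormalBasis ℝ (LinearMap.range J)ᗮ).reindex (finCongr hdim)).repr
  -- the decomposition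
  have hgauss := stdGaussian_map_adjoint_prod_eq J hJiso J' hJadj e
  have hdecomp := fun w : 𝔼 => (norm_sq_eq_of_isometry_adjoint J hJiso J' hJadj w).2
  -- the map `T`
  let P := (LinearMap.range J)ᗮ.orthogonalProjectionOnto
  refine ⟨fun w => (Λ (fun _ => s⁻¹) (toLp 2 w), (Λ r (toLp 2 w), e (P (toLp 2 w)))), ?_, ?_, ?_⟩
  · -- measurability
    have hc1 : Continuous fun w : 𝔼 => Λ (fun _ => s⁻¹) w := (Λ _).continuous_of_finiteDimensional
    have hc2 : Continuous fun w : 𝔼 => Λ r w := (Λ _).continuous_of_finiteDimensional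
    have hc3 : Continuous fun w : 𝔼 => e (P w) := e.continuous.comp P.continuous
    exact ((hc1.measurable.prodMk (hc2.measurable.prodMk hc3.measurable)).comp
      (WithLp.measurable_toLp 2 _))
  · -- the law
    have hS : Measurable fun w : 𝔼 => (J' w, e (P w)) :=
      (J'.continuous_of_finiteDimensional.measurable.prodMk
        (e.continuous.comp P.continuous).measurable)
    have hRm : Measurable (⇑(MeasurableEquiv.prodAssoc : (V × V) × EuclideanSpace ℝ (Fin ((N - 1) *
        finrank ℝ V)) ≃ᵐ _) ∘ Prod.map (ofLp : G → V × V) id) :=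
      (MeasurableEquiv.measurable _).comp ((WithLp.measurable_ofLp 2 _).prodMap measurable_id)
    have hT : (fun w : Fin (N + 1) → V =>
        (Λ (fun _ => s⁻¹) (toLp 2 w), (Λ r (toLp 2 w), e (P (toLp 2 w))))) =
        ((⇑(MeasurableEquiv.prodAssoc : (V × V) × EuclideanSpace ℝ (Fin ((N - 1) * finrank ℝ V)) ≃ᵐ _) ∘
          Prod.map (ofLp : G → V × V) id) ∘ fun w : 𝔼 => (J' w, e (P w))) ∘
          (toLp 2 : (Fin (N + 1) → V) → 𝔼) := by
      funext w; rfl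
    rw [hT, ← stdGaussian_piLp_map_ofLp (ι := Fin (N + 1)) (A := V),
      Measure.map_map ((hRm.comp hS).comp (WithLp.measurable_toLp 2 _)) (WithLp.measurable_ofLp 2 _),
      show (((⇑(MeasurableEquiv.prodAssoc : (V × V) × EuclideanSpace ℝ (Fin ((N - 1) * finrank ℝ V))
        ≃ᵐ _) ∘ Prod.map (ofLp : G → V × V) id) ∘ fun w : 𝔼 => (J' w, e (P w))) ∘
        (toLp 2 : (Fin (N + 1) → V) → 𝔼)) ∘ (ofLp : 𝔼 → Fin (N + 1) → V) =
        (⇑(MeasurableEquiv.prodAssoc : (V × V) × EuclideanSpace ℝ (Fin ((N - 1) * finrank ℝ V))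
        ≃ᵐ _) ∘ Prod.map (ofLp : G → V × V) id) ∘ fun w : 𝔼 => (J' w, e (P w)) from
        funext fun x => rfl,
      ← Measure.map_map hRm hS, hgauss, ← Measure.map_map (MeasurableEquiv.measurable _)
        ((WithLp.measurable_ofLp 2 _).prodMap measurable_id),
      ← Measure.map_prod_map _ _ (WithLp.measurable_ofLp 2 (V × V)) measurable_id, Measure.map_id,
      stdGaussian_prod_map_ofLp, Measure.prodAssoc_prod]
  · intro w
    refine ⟨?_, ?_, ?_⟩
    · show ∑ i, s⁻¹ • (toLp 2 w : 𝔼) i = s⁻¹ • ∑ i, w i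
      rw [Finset.smul_sum]
    · show w 0 = s⁻¹ • ∑ i, s⁻¹ • (toLp 2 w : 𝔼) i + (t / s) • ∑ i, r i • (toLp 2 w : 𝔼) i
      simp only [Finset.smul_sum, smul_smul, ← Finset.sum_add_distrib, ← add_smul]
      rw [Fin.sum_univ_succ, hr0, S4, one_smul]
      simp only [hrs, S5, zero_smul, Finset.sum_const_zero, add_zero]
    · show ∑ i, ‖w i‖ ^ 2 = ‖Λ (fun _ => s⁻¹) (toLp 2 w)‖ ^ 2 + ‖Λ r (toLp 2 w)‖ ^ 2 +
        ‖e (P (toLp 2 w))‖ ^ 2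
      have h1 : ‖J' (toLp 2 w)‖ ^ 2 = ‖Λ (fun _ => s⁻¹) (toLp 2 w)‖ ^ 2 + ‖Λ r (toLp 2 w)‖ ^ 2 := by
        rw [hJ', WithLp.prod_norm_sq_eq_of_L2, WithLp.toLp_fst, WithLp.toLp_snd]
      rw [LinearIsometryEquiv.norm_map, ← h1, ← hdecomp, PiLp.norm_sq_eq_of_L2]

end Helmert

end Literature.Probability.Distributions

end
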